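import Mathlib.Analysis.Calculus.InverseFunctionTheorem.ContDiff
import Mathlib.Analysis.Calculus.FDeriv.Analytic
import Mathlib.Analysis.Calculus.FDeriv.Prod
import Mathlib.Analysis.Calculus.FDeriv.Pi
import Mathlib.Analysis.Calculus.ContDiff.Operations
import Mathlib.Analysis.Analytic.Constructions
import Mathlib.Analysis.Analytic.Uniqueness
import Mathlib.Analysis.Complex.Basic
import Mathlib.LinearAlgebra.FiniteDimensional.Lemmas
import Mathlib.Topology.Algebra.Module.FiniteDimension
import HarnessLib

/-!
# Smooth hypersurface germs in `ℂ^ι`: the implicit-function chart and the transversal-union lemma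

Family `hodge`, layer `Literature/Analysis/Complex`; theorems only (no definition, no named fact).

For a holomorphic function `α` near `z₀ ∈ ℂ^ι` (`ι` finite) with `∂α/∂x_k (z₀) ≠ 0`:

* `exists_implicitChart_of_analyticAt` — the holomorphic IMPLICIT FUNCTION THEOREM in chart form
  (Griffiths–Harris Ch. 0 §1; Gunning–Rossi I §B Thm. 9): on an open `Ω ∋ z₀` the zero set `{α = 0}` is the
  graph, over an open set `T` of the remaining coordinates `(x_j)_{j ≠ k}`, of a map `ψ` analytic on `T`
  (two-sided description: `z ∈ Ω, α z = 0 ⇒ π z ∈ T ∧ ψ (π z) = z` and `w ∈ T ⇒ ψ w ∈ Ω ∧ α (ψ w) = 0 ∧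
  π (ψ w) = w`).  The proof is the tree's `Literature.NumberTheory.Transcendental.exists_implicitChart`
  (polynomial equations) rerun for one analytic equation, from Mathlib's inverse function theorem
  `ContDiffAt.toOpenPartialHomeomorph`.
* `eventually_zero_of_zero_subset_union` — the TRANSVERSAL-UNION LEMMA: if `β, γ` are holomorphic near `z₀`,
  `α z₀ = β z₀ = 0`, `dβ(z₀)` does not vanish on `ker dα(z₀)` (the smooth germs `{α = 0}`, `{β = 0}` are
  transversal) and `{α = 0} ⊆ {β = 0} ∪ {γ = 0}` near `z₀`, then `{α = 0} ⊆ {γ = 0}` near `z₀`.  (On the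
  chart, `β ∘ ψ` is analytic with non-zero differential, so `{β ∘ ψ ≠ 0}` is dense by the identity theorem,
  and `γ ∘ ψ` vanishes there, hence everywhere by continuity.)  Used by the Hodge-conjecture cell
  (`hodge-nonav`, crux K1-B, piece GEN) to identify the two local branches of the discriminant at a form
  with an exchanged pair of nodes on the invariant linear system.

## References

* [GriffithsHarris1978] P. Griffiths, J. Harris, *Principles of Algebraic Geometry*, Wiley 1978, Ch. 0 §1
  (implicit function theorem, analytic hypersurfaces) and §2.
-/

noncomputable section

open _root_.Topology _root_.Filter Set
open scoped ContDiff

namespace Literature.Analysis.Complex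

variable {ι : Type} [Fintype ι] [DecidableEq ι]

omit [Fintype ι] in
/-- A vector with all coordinates `j ≠ k` equal to zero is a multiple of `e_k`. [folklore] -/
private theorem eq_single_of_drop_eq_zero (k : ι) {v : ι → ℂ} (hv : (fun t : {j : ι // j ≠ k} => v t.1) = 0) :
    v = Pi.single k (v k) := by
  funext j
  by_cases hj : j = k
  · subst hj; simp
  · have := congr_fun hv ⟨j, hj⟩
    simpa [Pi.single_apply, hj] using this

/-- **Holomorphic implicit function theorem, chart form, one equation.**  Let `α : ℂ^ι → ℂ` be analytic
at `z₀` with `dα(z₀) e_k ≠ 0`.  Then there are an open `Ω ∋ z₀`, an open set `T` of the coordinates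
`(x_j)_{j ≠ k}` and `ψ` analytic on `T` such that `{α = 0} ∩ Ω` is exactly the graph `ψ(T)`:
`z ∈ Ω, α z = 0 ⇒ π z ∈ T, ψ (π z) = z`, and `w ∈ T ⇒ ψ w ∈ Ω, α (ψ w) = 0, π (ψ w) = w`
(`π` = forgetting the `k`-th coordinate). [cite: GriffithsHarris1978, Ch. 0 §1 (implicit function theorem)] -/
theorem exists_implicitChart_of_analyticAt (k : ι) {α : (ι → ℂ) → ℂ} {z₀ : ι → ℂ}
    (hα : AnalyticAt ℂ α z₀) (hk : fderiv ℂ α z₀ (Pi.single k 1) ≠ 0) :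
    ∃ (Ω : Set (ι → ℂ)) (T : Set ({j : ι // j ≠ k} → ℂ)) (ψ : ({j : ι // j ≠ k} → ℂ) → (ι → ℂ)),
      IsOpen Ω ∧ z₀ ∈ Ω ∧ IsOpen T ∧ AnalyticOnNhd ℂ ψ T ∧
      (∀ z ∈ Ω, α z = 0 → (fun t : {j : ι // j ≠ k} => z t.1) ∈ T ∧ ψ (fun t => z t.1) = z) ∧
      (∀ w ∈ T, ψ w ∈ Ω ∧ α (ψ w) = 0 ∧ (fun t : {j : ι // j ≠ k} => ψ w t.1) = w) := by
  classical
  let π : (ι → ℂ) →L[ℂ] ({j : ι // j ≠ k} → ℂ) :=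
    ContinuousLinearMap.pi fun t => ContinuousLinearMap.proj (R := ℂ) (φ := fun _ : ι => ℂ) t.1
  let D : (ι → ℂ) →L[ℂ] ℂ := fderiv ℂ α z₀
  let G : (ι → ℂ) → ({j : ι // j ≠ k} → ℂ) × ℂ := fun z => (π z, α z)
  have hGzero : ∀ z, α z = 0 → G z = ((fun t : {j : ι // j ≠ k} => z t.1), 0) := fun z hz =>
    Prod.ext rfl hz
  have hG : HasFDerivAt G (π.prod D) z₀ := π.hasFDerivAt.prodMk hα.differentiableAt.hasFDerivAt
  -- the derivative is injective ...
  have hinj : Function.Injective (π.prod D) := by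
    refine (injective_iff_map_eq_zero _).mpr fun v hv => ?_
    have hv1 : (fun t : {j : ι // j ≠ k} => v t.1) = 0 := congr_arg Prod.fst hv
    have hv2 : D v = 0 := congr_arg Prod.snd hv
    have hvk := eq_single_of_drop_eq_zero k hv1
    have hsingle : Pi.single k (v k) = v k • (Pi.single k (1 : ℂ) : ι → ℂ) := by
      funext j
      by_cases hj : j = k
      · subst hj; simp
      · simp [hj]
    have : v k • D (Pi.single k 1) = 0 := by
      rw [← map_smul, ← hsingle, ← hvk]
      exact hv2
    rcases smul_eq_zero.mp this with h0 | h0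
    · rw [hvk, h0, Pi.single_zero]
    · exact absurd h0 hk
  -- ... hence bijective, by a dimension count
  have hrank : Module.finrank ℂ (ι → ℂ) = Module.finrank ℂ (({j : ι // j ≠ k} → ℂ) × ℂ) := by
    simp only [Module.finrank_prod, Module.finrank_fintype_fun_eq_card, Module.finrank_self]
    rw [← Fintype.card_option]
    exact Fintype.card_congr (Equiv.optionSubtypeNe k).symm
  have hbij : Function.Bijective (π.prod D) :=
    ⟨hinj, (LinearMap.injective_iff_surjective_of_finrank_eq_finrank hrank
      (f := (π.prod D).toLinearMap)).mp hinj⟩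
  let Geq : (ι → ℂ) ≃L[ℂ] (({j : ι // j ≠ k} → ℂ) × ℂ) :=
    (LinearEquiv.ofBijective (π.prod D).toLinearMap hbij).toContinuousLinearEquiv
  have hG' : HasFDerivAt G (Geq : (ι → ℂ) →L[ℂ] (({j : ι // j ≠ k} → ℂ) × ℂ)) z₀ := by
    convert hG using 1
    ext1 v
    simp [Geq]
  -- `G` is analytic
  have hGc : ContDiffAt ℂ ω G z₀ := π.contDiff.contDiffAt.prodMk hα.contDiffAt
  have hn : (ω : WithTop ℕ∞) ≠ 0 := by simp
  -- the inverse function theorem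
  let Φ := hGc.toOpenPartialHomeomorph G hG' hn
  have hΦ : (Φ : (ι → ℂ) → ({j : ι // j ≠ k} → ℂ) × ℂ) = G := rfl
  have hz₀Φ : z₀ ∈ Φ.source := hGc.mem_toOpenPartialHomeomorph_source hG' hn
  have hsymm : ContDiffAt ℂ ω Φ.symm (G z₀) := hGc.to_localInverse hG' hn
  let N : Set (({j : ι // j ≠ k} → ℂ) × ℂ) := Φ.target ∩ {y | AnalyticAt ℂ Φ.symm y}
  have hN : IsOpen N := Φ.open_target.inter (isOpen_analyticAt ℂ Φ.symm)
  have hz₀N : G z₀ ∈ N := ⟨Φ.map_source hz₀Φ, hsymm.analyticAt⟩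
  let Ω : Set (ι → ℂ) := Φ.source ∩ G ⁻¹' N
  let emb : ({j : ι // j ≠ k} → ℂ) → ({j : ι // j ≠ k} → ℂ) × ℂ := fun w => (w, 0)
  have hemb : Continuous emb := continuous_id.prodMk continuous_const
  have hemb' : ∀ w, AnalyticAt ℂ emb w := fun w => analyticAt_id.prod analyticAt_const
  let T : Set ({j : ι // j ≠ k} → ℂ) := emb ⁻¹' N
  let ψ : ({j : ι // j ≠ k} → ℂ) → (ι → ℂ) := fun w => Φ.symm (emb w)
  refine ⟨Ω, T, ψ, Φ.isOpen_inter_preimage hN, ⟨hz₀Φ, hz₀N⟩, hN.preimage hemb,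
    fun w hw => (hw.2).comp (hemb' w), fun z hz hαz => ?_, fun w hw => ?_⟩
  · have hGz : G z = emb (fun t : {j : ι // j ≠ k} => z t.1) := hGzero z hαz
    refine ⟨?_, ?_⟩
    · change emb _ ∈ N
      rw [← hGz]
      exact hz.2
    · change Φ.symm (emb _) = z
      rw [← hGz, ← hΦ]
      exact Φ.left_inv hz.1
  · have hwt : emb w ∈ Φ.target := hw.1
    have hsrc : ψ w ∈ Φ.source := Φ.map_target hwt
    have hGψ : G (ψ w) = emb w := by
      rw [← hΦ]
      exact Φ.right_inv hwt
    refine ⟨⟨hsrc, ?_⟩, ?_, ?_⟩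
    · change G (ψ w) ∈ N
      rw [hGψ]
      exact hw
    · have := congr_arg Prod.snd hGψ
      simpa [G, emb] using this
    · have := congr_arg Prod.fst hGψ
      simpa [G, emb, π] using this

/-- A non-zero continuous linear functional on `ℂ^ι` is non-zero on some basis vector `e_k`. [folklore] -/
private theorem exists_apply_single_ne_zero {L : (ι → ℂ) →L[ℂ] ℂ} (hL : L ≠ 0) :
    ∃ k, L (Pi.single k 1) ≠ 0 := by
  classical
  by_contra h
  push Not at h
  apply hL
  ext v
  have hv : v = ∑ i, v i • (Pi.single i (1 : ℂ) : ι → ℂ) := by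
    funext j
    simp only [Finset.sum_apply, Pi.smul_apply, Pi.single_apply, smul_eq_mul, mul_ite, mul_one, mul_zero,
      Finset.sum_ite_eq, Finset.mem_univ, if_true]
  rw [hv, map_sum]
  simp [h]

/-- **Transversal-union lemma for smooth hypersurface germs.**  Let `α, β` be holomorphic and `γ` continuous
on an open `S ∋ z₀` in `ℂ^ι`, with `α z₀ = β z₀ = 0`, `dα(z₀) ≠ 0`, and `dβ(z₀) v ≠ 0` for some `v ∈ ker dα(z₀)`
(the germs `{α = 0}` and `{β = 0}` at `z₀` are smooth and transversal).  If `{α = 0} ⊆ {β = 0} ∪ {γ = 0}` on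
`S`, then `{α = 0} ⊆ {γ = 0}` on a smaller open neighbourhood `S' ∋ z₀`.  (Chart `ψ` of `{α = 0}` by the
implicit function theorem; `β ∘ ψ` is analytic with non-zero differential at `π z₀`, so by the identity
theorem `{β ∘ ψ ≠ 0}` is dense near `π z₀`; there `γ ∘ ψ = 0`, hence everywhere by continuity.)
[cite: GriffithsHarris1978, Ch. 0 §1 (analytic hypersurfaces; identity theorem)] -/
theorem exists_nhds_zero_of_zero_subset_union {α β γ : (ι → ℂ) → ℂ} {z₀ : ι → ℂ} {S : Set (ι → ℂ)}
    (hS : IsOpen S) (hz₀ : z₀ ∈ S) (hα : AnalyticOnNhd ℂ α S) (hβ : AnalyticOnNhd ℂ β S)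
    (hγ : ContinuousOn γ S) (hα0 : α z₀ = 0)
    (hαne : fderiv ℂ α z₀ ≠ 0) (htr : ∃ v, fderiv ℂ α z₀ v = 0 ∧ fderiv ℂ β z₀ v ≠ 0)
    (hcover : ∀ z ∈ S, α z = 0 → β z = 0 ∨ γ z = 0) :
    ∃ S' : Set (ι → ℂ), IsOpen S' ∧ z₀ ∈ S' ∧ S' ⊆ S ∧ ∀ z ∈ S', α z = 0 → γ z = 0 := by
  classical
  obtain ⟨k, hk⟩ := exists_apply_single_ne_zero hαne
  obtain ⟨Ω, T, ψ, hΩ, hz₀Ω, hT, hψ, hzero, hgraph⟩ :=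
    exists_implicitChart_of_analyticAt (ι := ι) k (hα z₀ hz₀) hk
  -- notation: `π z = (z_j)_{j ≠ k}`
  let π : (ι → ℂ) →L[ℂ] ({j : ι // j ≠ k} → ℂ) :=
    ContinuousLinearMap.pi fun t => ContinuousLinearMap.proj (R := ℂ) (φ := fun _ : ι => ℂ) t.1
  have hπ : ∀ z : ι → ℂ, π z = fun t => z t.1 := fun z => rfl
  -- shrink `T` so that `ψ` lands in `S`
  have hψc : ContinuousOn ψ T := hψ.continuousOn
  let T' : Set ({j : ι // j ≠ k} → ℂ) := T ∩ ψ ⁻¹' S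
  have hT' : IsOpen T' := hψc.isOpen_inter_preimage hT hS
  set w₀ : {j : ι // j ≠ k} → ℂ := fun t => z₀ t.1 with hw₀def
  have hw₀T : w₀ ∈ T := (hzero z₀ hz₀Ω hα0).1
  have hψw₀ : ψ w₀ = z₀ := (hzero z₀ hz₀Ω hα0).2
  have hw₀T' : w₀ ∈ T' := ⟨hw₀T, by change ψ w₀ ∈ S; rw [hψw₀]; exact hz₀⟩
  obtain ⟨r, hr, hball⟩ := Metric.isOpen_iff.mp hT' w₀ hw₀T'
  -- `g := β ∘ ψ` is analytic on the ball
  have hgan : AnalyticOnNhd ℂ (fun w => β (ψ w)) (Metric.ball w₀ r) := fun w hw =>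
    (hβ (ψ w) (hball hw).2).comp (hψ w (hball hw).1)
  -- and not identically zero near `w₀`: its differential at `w₀` does not kill `π v`
  have hnot : ¬ ((fun w => β (ψ w)) =ᶠ[𝓝 w₀] 0) := by
    intro hg0
    obtain ⟨v, hvα, hvβ⟩ := htr
    have hψd : DifferentiableAt ℂ ψ w₀ := (hψ w₀ hw₀T).differentiableAt
    have hαd : DifferentiableAt ℂ α (ψ w₀) := by rw [hψw₀]; exact (hα z₀ hz₀).differentiableAt
    have hβd : DifferentiableAt ℂ β (ψ w₀) := by rw [hψw₀]; exact (hβ z₀ hz₀).differentiableAt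
    set v' := fderiv ℂ ψ w₀ (π v) with hv'def
    have hTn : T ∈ 𝓝 w₀ := hT.mem_nhds hw₀T
    -- (i) `α ∘ ψ = 0` near `w₀`
    have h1 : fderiv ℂ α z₀ v' = 0 := by
      have hev : (fun w => α (ψ w)) =ᶠ[𝓝 w₀] fun _ => (0 : ℂ) :=
        Filter.eventually_of_mem hTn fun w hw => (hgraph w hw).2.1
      have hfd : fderiv ℂ (fun w => α (ψ w)) w₀ = 0 := by rw [hev.fderiv_eq]; simp
      have hchain : fderiv ℂ (fun w => α (ψ w)) w₀ = (fderiv ℂ α (ψ w₀)).comp (fderiv ℂ ψ w₀) :=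
        fderiv_comp w₀ hαd hψd
      have := congr_arg (fun L : ({j : ι // j ≠ k} → ℂ) →L[ℂ] ℂ => L (π v)) (hchain.symm.trans hfd)
      simpa [hψw₀] using this
    -- (ii) `π ∘ ψ = id` near `w₀`
    have h2 : π v' = π v := by
      have hev : (fun w => π (ψ w)) =ᶠ[𝓝 w₀] fun w => w :=
        Filter.eventually_of_mem hTn fun w hw => by
          show π (ψ w) = w
          rw [hπ]; exact (hgraph w hw).2.2
      have hfd : fderiv ℂ (fun w => π (ψ w)) w₀ = ContinuousLinearMap.id ℂ _ := by
        rw [hev.fderiv_eq]; exact fderiv_id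
      have hchain : fderiv ℂ (fun w => π (ψ w)) w₀ = π.comp (fderiv ℂ ψ w₀) := by
        have := fderiv_comp w₀ (π.differentiableAt) hψd (𝕜 := ℂ) (g := (π : (ι → ℂ) → _)) (f := ψ)
        rw [π.fderiv] at this
        exact this
      have := congr_arg (fun L : ({j : ι // j ≠ k} → ℂ) →L[ℂ] ({j : ι // j ≠ k} → ℂ) => L (π v))
        (hchain.symm.trans hfd)
      simpa using this
    -- (iii) `β ∘ ψ = 0` near `w₀` (the assumption to refute)
    have h3 : fderiv ℂ β z₀ v' = 0 := by
      have hfd : fderiv ℂ (fun w => β (ψ w)) w₀ = 0 := by rw [hg0.fderiv_eq]; simp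
      have hchain : fderiv ℂ (fun w => β (ψ w)) w₀ = (fderiv ℂ β (ψ w₀)).comp (fderiv ℂ ψ w₀) :=
        fderiv_comp w₀ hβd hψd
      have := congr_arg (fun L : ({j : ι // j ≠ k} → ℂ) →L[ℂ] ℂ => L (π v)) (hchain.symm.trans hfd)
      simpa [hψw₀] using this
    -- (iv) `v' - v ∈ ker π ∩ ker dα(z₀) = 0`
    have hdrop : (fun t : {j : ι // j ≠ k} => (v' - v) t.1) = 0 := by
      have : π (v' - v) = 0 := by rw [map_sub, h2, sub_self]
      simpa [hπ] using this
    have hvk := eq_single_of_drop_eq_zero k hdrop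
    have hsingle : Pi.single k ((v' - v) k) = (v' - v) k • (Pi.single k (1 : ℂ) : ι → ℂ) := by
      funext j
      by_cases hj : j = k
      · subst hj; simp
      · simp [hj]
    have hc : (v' - v) k = 0 := by
      have h0 : fderiv ℂ α z₀ (v' - v) = 0 := by rw [map_sub, h1, hvα, sub_self]
      rw [hvk, hsingle, map_smul, smul_eq_mul] at h0
      exact (mul_eq_zero.mp h0).resolve_right hk
    have hvv : v' = v := by
      have : v' - v = 0 := by rw [hvk, hc, Pi.single_zero]
      exact sub_eq_zero.mp this
    exact hvβ (by rw [← hvv]; exact h3)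
  -- identity theorem: `β ∘ ψ` is not identically zero near ANY point of the ball
  have hnot' : ∀ w₁ ∈ Metric.ball w₀ r, ¬ ((fun w => β (ψ w)) =ᶠ[𝓝 w₁] 0) := by
    intro w₁ hw₁ hg1
    have hall := hgan.eqOn_zero_of_preconnected_of_eventuallyEq_zero
      (convex_ball w₀ r).isPreconnected hw₁ hg1
    exact hnot (Filter.eventually_of_mem (Metric.isOpen_ball.mem_nhds (Metric.mem_ball_self hr))
      fun w hw => hall hw)
  -- hence `γ ∘ ψ = 0` on the ball
  have hγψ : ∀ w₁ ∈ Metric.ball w₀ r, γ (ψ w₁) = 0 := by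
    intro w₁ hw₁
    have hfreq : ∃ᶠ w in 𝓝 w₁, γ (ψ w) = 0 := by
      have hne : ∃ᶠ w in 𝓝 w₁, β (ψ w) ≠ 0 := Filter.not_eventually.mp (hnot' w₁ hw₁)
      have hinball : ∀ᶠ w in 𝓝 w₁, w ∈ Metric.ball w₀ r := Metric.isOpen_ball.mem_nhds hw₁
      refine (hne.and_eventually hinball).mono fun w hw => ?_
      have hwT' := hball hw.2
      rcases hcover (ψ w) hwT'.2 (hgraph w hwT'.1).2.1 with h | h
      · exact absurd h hw.1
      · exact h
    have hcont : ContinuousAt (fun w => γ (ψ w)) w₁ := by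
      have hwT' := hball hw₁
      exact (hγ.continuousAt (hS.mem_nhds hwT'.2)).comp
        (hψc.continuousAt (hT.mem_nhds hwT'.1))
    by_contra hne0
    obtain ⟨w, hw1, hw2⟩ := ((hcont.eventually_ne hne0).and_frequently hfreq).exists
    exact hw1 hw2
  -- conclusion on `S' = Ω ∩ S ∩ π⁻¹(ball)`
  refine ⟨Ω ∩ S ∩ π ⁻¹' Metric.ball w₀ r, (hΩ.inter hS).inter (Metric.isOpen_ball.preimage π.continuous),
    ⟨⟨hz₀Ω, hz₀⟩, ?_⟩, fun z hz => hz.1.2, fun z hz hαz => ?_⟩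
  · change π z₀ ∈ Metric.ball w₀ r
    rw [hπ]
    exact Metric.mem_ball_self hr
  · have h1 := hzero z hz.1.1 hαz
    have hzb : (fun t : {j : ι // j ≠ k} => z t.1) ∈ Metric.ball w₀ r := by
      have := hz.2; rwa [Set.mem_preimage, hπ] at this
    rw [← h1.2]
    exact hγψ _ hzb

end Literature.Analysis.Complex

end
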